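/-
Copyright: lit-balaban cell, Phase-2 proof seat p24 (gen 25).  Released under Apache 2.0 license as described in the
file LICENSE.
-/
import Literature.MathematicalPhysics.QuantumFieldTheory.Balaban1983to89.B3GkZeroLattice
import Literature.MathematicalPhysics.QuantumFieldTheory.Balaban1983to89.B4Lemma22ZeroBoxLpLq

/-!
# `Balaban1983to89.B4Lemma22ZeroLatticeLpLq` — [Balaban1983RegularityDecay] Lemma 2.2 (2.17) OFF THE DIAGONAL FOR
# `□ ↦` THE WHOLE LATTICE `ηℤ^{d+1}`, `A = 0`: ALL `1 ≤ p ≤ q ≤ ∞` WITH `1/p − 1/q ≤ 1/p₁`, `p₁ > d + 1` (the lattice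
# dimension), ALL THREE OPERATORS `G_k(0)`, `D^η_μG_k(0)`, `G_k(0)D^{η*}_μ`, in the `η`-weighted norms of (2.11) — the
# zero-field box theorem `B4Lemma22ZeroBoxLpLq.Gfine_lpN_bound` on the centred cubes of `B3GkZeroLattice`, in the limit

statement-level skeleton of published theorems with citation tags; proofs where landed; nothing here is a claim about
the Yang–Mills mass gap

CITATION HEADER.  T. Bałaban, *Regularity and decay of lattice Green's functions*, Commun. Math. Phys. **89** (1983)
571–597, doi:10.1007/bf01214744 [Balaban1983RegularityDecay] (cell paper B4; held text
`paper:balaban1983-cmp89-regularity-decay`, journal page = PDF page + 570): p. 577–578 [PDF 7–8] Lemma 2.2 (2.17) and the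
norms (2.11), p. 583 [PDF 13] the proof of (2.17) for `G_k(□)` ((2.40)–(2.41), duality, Riesz–Thorin, the figure),
p. 584 [PDF 14] «valid for all such sets»; [Balaban1983Higgs3] p. 433 (the propagator `G_k(0)` on `ηℤ^{d+1}`).  Unit
`lit-balaban-p24` gen 25; HOME `run/shared/lean/pub/lit-balaban/`; SKELETON row **B4.Lem2.2** (owner r01) — cells only,
proved-headed.  Companions: `B4Lemma22ZeroLattice` (the diagonal `q = p`), `B4Thm110ZeroLattice` ∕ `B4Thm19ZeroLattice`
((1.10) ∕ (1.9) on the lattice); the box form of this file is b-lineage's `B4Lemma22ZeroBoxLpLq` (node 16), used BY NAME.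

WHAT IS PRINTED.  p. 577–578, Lemma 2.2: «… and a constant c₂ depending on d, p₁, such that ‖G_k(□,Ã)f‖_q,
‖D^η_{Ã,μ}G_k(□,Ã)f‖_q, ‖G_k(□,Ã)D^{η*}_{Ã,μ}f‖_q ≦ c₂‖f‖_p (2.17) for 1 ≦ p, q ≦ ∞, satisfying the condition
1/p − 1/p₁ ≦ 1/q ≦ 1/p with p₁ > d.»  p. 583: «Now we will prove that the operators G_k(□), ∂^η_μG_k(□), G_k(□)∂^{η*}_μ are
bounded operators from L^{p₁}(□) with p₁ > d to L^∞(□). We will use again the representation (2.34). … (2.40) Hence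
|(G_k(□)∂^{η*}_μf)(x)| ≦ … ≦ c′₂‖f‖_{p₁} (2.41) for x ∈ □, p₁ > d …. Again by the duality argument we get that the operator
G_k(□) and its first order derivatives are bounded operators from L¹(□) to L^{p′₁}(□), p′₁^{−1} + p₁^{−1} = 1. The
Riesz-Thorin Theorem gives us finally (2.17) for G_k(□) and for all p, q described in the figure» ⟦the parallelogram
1/p − 1/p₁ ≦ 1/q ≦ 1/p⟧.  p. 584: «This part of the argument is valid for an arbitrary rectangular parallelepiped □ built of
unit blocks, so the inequalities are valid for all such sets.»  The print's `d` IS the lattice dimension (p. 572 «the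
lattice ηZ^d»); in this package the lattice is `Fin (d+1) → ℤ`, so «p₁ > d» reads `p₁ > d + 1`.

WHAT THIS MODULE PROVES (kernel-checked; theorems only; 0 `def`; 0 `sorry`; axioms standard), in the units of the
zero-field lineage: `n = L^k = η^{−1}` fine points per unit block, `L = ℓ + 1 ≥ 2`, running coefficient `a_k`, window
`a ∈ [a₋,a₊]`, `m² ∈ [0,m²₊]`, `G_k(0) = B3GkZeroLattice.GkLat` (matrix units, `(G_k(0)f)(x) = Σ_{x′}G_k(0)(x,x′)f(x′)`), the
three kernels `K^{(0)}(x,x′) = G_k(0)(x,x′)`, `K^{(1)}(x,x′) = n(G_k(0)(x+e_μ,x′) − G_k(0)(x,x′))` (`∂^η_μG_k(0)`, fine units),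
`K^{(2)}(x,x′) = n(G_k(0)(x,x′+e_μ) − G_k(0)(x,x′))` (`G_k(0)∂^{η*}_μ`), exponents `s = 1/p`, `t = 1/q`, and the `η`-WEIGHTED
norms of (2.11) ∕ b04's `ZeroFieldCube.lpN`: `‖f‖_p = (η^{d+1}Σ|f|^p)^{1/p}` (for `q > p` the weights do NOT cancel).  For
every `p₁ > d + 1` ONE constant `c₂ > 0` (depending on `d`, `L`, the window and `p₁` only; one per theorem):
* §3 **(2.17), `1 ≤ p ≤ q < ∞`, `1/p − 1/q ≤ 1/p₁`, all three operators** — `GkLat_lpq_le`, `GkLatD_lpq_le`, `GkLatDadj_lpq_le`: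
  for every `k ≥ 1`, window point, axis, all `0 < t ≤ s ≤ 1` with `s − 1/p₁ ≤ t`, every finite `S` (support of the datum)
  and finite output window `Λ`, every `f : ℤ^{d+1} → ℝ`:
  `(η^{d+1}Σ_{x∈Λ}|Σ_{x′∈S}K^{(m)}(x,x′)f(x′)|^{1/t})^t ≤ c₂(η^{d+1}Σ_{x′∈S}|f(x′)|^{1/s})^s`; the series forms over the whole
  lattice `GkLat_lpq_tsum_le`, `GkLatD_lpq_tsum_le`, `GkLatDadj_lpq_tsum_le` (summability of `|K^{(m)}f|^q` and
  `‖K^{(m)}f‖_q ≤ c₂‖f‖_p`).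
* §3 **`q = ∞`, `p ≥ p₁` — (2.41) on the lattice** — `GkLat_sup_lp_le`, `GkLatD_sup_lp_le`, `GkLatDadj_sup_lp_le`:
  `|Σ_{x′∈S}K^{(m)}(x,x′)f(x′)| ≤ c₂(η^{d+1}Σ_{x′∈S}|f(x′)|^{1/s})^s` for `0 < s ≤ 1/p₁`, every point `x`; and the corner
  `p = q = ∞` for all three operators at once, `GkLat_three_sup_le` (`≤ c₂F_∞` for `|f| ≤ F_∞` on `S`).
  Together with `B4Lemma22ZeroLattice.GkLat_apply_lp_le` (the diagonal) this is the print's full parallelogram for `G_k(0)`.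
* THE ROUTE (§§1–2): for `T` beyond a common label radius of `Λ ∪ S` and their `μ`-successors, the cube `C_T` of
  `B3GkZeroLattice` is a member of the zero-field box family (`B4Ineq19ZeroBoxEta.BoxInst`, `R₀ = □`, charge `0`); the datum
  is moved into `C_T` by the centring `ctr` (zero elsewhere), b-lineage's `Gfine_lpN_bound` (kernel Young per scale of the
  representation (2.40), summed by Minkowski along the scales — their recorded divergence from the print's Riesz–Thorin
  step, same conclusion) bounds `T^{(m)}[G_k(C_T,0)]` between the `lpN` norms with a constant independent of `T`, the three
  box kernels read at centred points ARE `g_T`, `n(g_T(x+e_μ,·) − g_T(x,·))`, `n(g_T(·,x′+e_μ) − g_T(·,x′))` (`kerOf_cube_*`,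
  `B3GkZeroLattice.gcube_eq`, `B4Lemma22ZeroBoxDerivDual.fwd`), the truncated lattice functional is dominated by the box norm
  (`transfer_*`), and `g_T → G_k(0)` entrywise (`B3GkZeroLattice.tendsto_gcube`) carries the bound to the limit.
* §4 non-vacuity (`d + 1 = 4`, `L = 2`, `p₁ = 5`, `(p,q) = (1,5/4)` and `(5,∞)`).

DICTIONARY / HONEST SCOPE.  (i) `A = 0` (`Ã = 0`: none of Lemma 2.2's field hypotheses is exercised), one component,
`□ ↦ ηℤ^{d+1}` read through the infinite-volume limit of Neumann cubes (p. 584 «valid for all such sets»; the print states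
(2.17) for parallelepipeds, the lattice is this package's reading, as in the companion files); sup-norm geometry of the
lineage; constants existential (depending also on `L` and the window; the print: «depending on d, p₁»).  (ii) Data are
finitely supported and outputs are finite windows or the whole-lattice series (`q < ∞`) ∕ single points (`q = ∞`); no
`lp`-space packaging; real-valued data (the kernels are real; complex data follow componentwise, not spelled out).
(iii) The diagonal `q = p < ∞` is NOT restated (it is `B4Lemma22ZeroLattice.GkLat_apply_lp_le`, counting form — the weights
cancel there); the exponentially weighted sup bounds are `B4Thm110ZeroLattice` ∕ `B4Thm19ZeroLattice`.  (iv) Value = Lemma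
2.2 (2.17) in its full `(p,q)`-range for the free infinite-lattice propagator and its two first-order difference operators;
cells only on B4.Lem2.2; NOT summit progress.
-/

namespace Literature.MathematicalPhysics.QuantumFieldTheory.Balaban1983to89.B4Lemma22ZeroLatticeLpLq

open Finset Filter Topology
open Literature.MathematicalPhysics.QuantumFieldTheory.Balaban1983to89.B4Reflection242 (boxDom blk)
open Literature.MathematicalPhysics.QuantumFieldTheory.Balaban1983to89.B4Thm110ZeroBox (Nf Gfine one_lt_L_real L_real_pos
  Linv_sq_bounds)
open Literature.MathematicalPhysics.QuantumFieldTheory.Balaban1983to89.B3GkZeroLattice (cubeM cubeM_pos ctr ctr_sub_ctr LabRad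
  labRad_sum ctr_mem gcube gcube_eq GkLat tendsto_gcube)
open Literature.MathematicalPhysics.QuantumFieldTheory.Balaban1983to89.B4Lower18 (boxDom_isBlockUnion)
open Literature.MathematicalPhysics.QuantumFieldTheory.Balaban1983to89.B4Ineq19ZeroBoxEta (BoxInst)
open Literature.MathematicalPhysics.QuantumFieldTheory.Balaban1983to89.B4Lemma21Zero (ZeroFieldCube)
open Literature.MathematicalPhysics.QuantumFieldTheory.Balaban1983to89.B4Lemma22ZeroBoxCube (toZFC)
open Literature.MathematicalPhysics.QuantumFieldTheory.Balaban1983to89.B4Lemma22ZeroBoxDerivDual (fwd fwd_val_of_mem)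
open Literature.MathematicalPhysics.QuantumFieldTheory.Balaban1983to89.B4Lemma22ZeroBoxLpLq (kerOf Gfine_lpN_bound lpN_nonneg
  abs_le_supN_cube supN_nonneg_cube)

noncomputable section

variable {d : ℕ}

/-! ## §0 Kernel helpers: centring, label radii, sums moved to a box -/

/-- kernel: `L^k ≥ 1`. [folklore] -/
private theorem one_le_n (ℓ k : ℕ) : 1 ≤ (ℓ + 1) ^ k := Nat.one_le_pow _ _ (by omega)

/-- kernel: centring commutes with the unit step `+e_μ`. [folklore] -/
private theorem ctr_add_single (n t : ℕ) (x : Fin (d + 1) → ℤ) (μ : Fin (d + 1)) :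
    ctr n t (x + Pi.single μ 1) = ctr n t x + Pi.single μ 1 := by
  unfold ctr; exact add_right_comm _ _ _

/-- kernel: a common label radius for a finite set of points. [folklore] -/
private theorem exists_labRad_finset (n : ℕ) (F : Finset (Fin (d + 1) → ℤ)) :
    ∃ R : ℕ, ∀ x ∈ F, LabRad n R x :=
  ⟨∑ x ∈ F, ∑ i, (blk n x i).natAbs, fun x hx => (labRad_sum n x).mono
    (Finset.single_le_sum (f := fun y => ∑ i, (blk n y i).natAbs) (fun _ _ => Nat.zero_le _) hx)⟩

/-- kernel: an injective relabelling of a finite partial sum of non-negative terms is dominated by the full finite sum.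
[folklore] -/
private theorem sum_attach_le_univ_sum {α β : Type*} [Fintype β] [DecidableEq β] (F : Finset α) (ι : ↥F → β)
    (hι : Function.Injective ι) (g : β → ℝ) (hg : ∀ b, 0 ≤ g b) :
    ∑ a ∈ F.attach, g (ι a) ≤ ∑ b, g b := by
  classical
  rw [← Finset.sum_image (f := g) (fun a _ b _ h => hι h)]
  exact Finset.sum_le_univ_sum_of_nonneg hg

/-- kernel: a sum over the points of a finite region `R` of a function supported on the (injective) image of `S ⊆ e⁻¹R`
is the sum over `S`. [folklore] -/
private theorem sum_subtype_eq_sum_of_support {R : Finset (Fin (d + 1) → ℤ)} (S : Finset (Fin (d + 1) → ℤ))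
    (e : (Fin (d + 1) → ℤ) → (Fin (d + 1) → ℤ)) (he : Function.Injective e) (hS : ∀ x ∈ S, e x ∈ R)
    (ψ : (Fin (d + 1) → ℤ) → ℝ) (hψ : ∀ z ∈ R, (∀ x ∈ S, e x ≠ z) → ψ z = 0) :
    ∑ y : ↥R, ψ y.1 = ∑ x ∈ S, ψ (e x) := by
  classical
  rw [Finset.sum_coe_sort R ψ, ← Finset.sum_image (f := ψ) (fun x _ y _ h => he h)]
  symm
  refine Finset.sum_subset (fun z hz => ?_) (fun z hzR hz => hψ z hzR fun x hx hxz => hz ?_)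
  · obtain ⟨x, hx, rfl⟩ := Finset.mem_image.1 hz
    exact hS x hx
  · exact Finset.mem_image.2 ⟨x, hx, hxz⟩

/-! ## §1 The transfer step: a datum on finitely many lattice points, moved into a box, and b04's `η`-weighted norms -/

section Transfer

variable (i : ZeroFieldCube d) (e einv : (Fin (d + 1) → ℤ) → (Fin (d + 1) → ℤ))
  (S : Finset (Fin (d + 1) → ℤ)) (f : (Fin (d + 1) → ℤ) → ℝ)

/-- kernel: the `r`-th powers of the datum moved into the box (`F(y) = f(e⁻¹y)` on `e(S)`, `0` elsewhere) sum to
`Σ_{x′∈S}|f(x′)|^r`. [folklore] -/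
private theorem sum_moved_rpow (h1 : ∀ x, einv (e x) = x) (h2 : ∀ z, e (einv z) = z) (hS : ∀ x ∈ S, e x ∈ i.R)
    {r : ℝ} (hr : r ≠ 0) :
    ∑ y : ↥i.R, |(if einv y.1 ∈ S then f (einv y.1) else 0)| ^ r = ∑ x ∈ S, |f x| ^ r := by
  classical
  have he : Function.Injective e := fun x y h => by rw [← h1 x, ← h1 y, h]
  rw [sum_subtype_eq_sum_of_support S e he hS (fun z => |(if einv z ∈ S then f (einv z) else 0)| ^ r) ?_]
  · exact Finset.sum_congr rfl fun x hx => by simp only [h1 x, if_pos hx]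
  · intro z _ hz
    have hzS : einv z ∉ S := fun hmem => hz (einv z) hmem (h2 z)
    simp only [if_neg hzS, abs_zero, Real.zero_rpow hr]

/-- kernel: the sup of the moved datum is at most any common bound `F_∞ ≥ 0` of `|f|` on `S`. [folklore] -/
private theorem supN_moved_le {Fsup : ℝ} (hF0 : 0 ≤ Fsup) (hf : ∀ x ∈ S, |f x| ≤ Fsup) :
    i.supN (fun y => if einv y.1 ∈ S then f (einv y.1) else 0) ≤ Fsup := by
  unfold ZeroFieldCube.supN
  split_ifs with h
  · refine Finset.sup'_le _ _ fun y _ => ?_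
    by_cases hy : einv y.1 ∈ S
    · simp only [if_pos hy]; exact hf _ hy
    · simp only [if_neg hy, abs_zero]; exact hF0
  · exact hF0

/-- kernel: a kernel operator of the box applied to the moved datum, read at a moved point `e(x)`, is the truncated
lattice sum `Σ_{x′∈S}K(x,x′)f(x′)` as soon as the box kernel at `(e(x), e(x′))` is `K(x,x′)`. [folklore] -/
private theorem moved_apply (h1 : ∀ x, einv (e x) = x) (h2 : ∀ z, e (einv z) = z) (hS : ∀ x ∈ S, e x ∈ i.R)
    (Tk : ↥i.R → ↥i.R → ℝ) (K : (Fin (d + 1) → ℤ) → (Fin (d + 1) → ℤ) → ℝ) {x : Fin (d + 1) → ℤ} (hx : e x ∈ i.R)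
    (hK : ∀ y : ↥i.R, einv y.1 ∈ S → Tk ⟨e x, hx⟩ y = K x (einv y.1)) :
    ∑ y : ↥i.R, Tk ⟨e x, hx⟩ y * (if einv y.1 ∈ S then f (einv y.1) else 0) = ∑ x' ∈ S, K x x' * f x' := by
  classical
  have he : Function.Injective e := fun x y h => by rw [← h1 x, ← h1 y, h]
  set ψ : (Fin (d + 1) → ℤ) → ℝ := fun z => if einv z ∈ S then K x (einv z) * f (einv z) else 0 with hψ
  have hpt : ∀ y : ↥i.R, Tk ⟨e x, hx⟩ y * (if einv y.1 ∈ S then f (einv y.1) else 0) = ψ y.1 := by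
    intro y
    by_cases hy : einv y.1 ∈ S
    · simp only [hψ, if_pos hy, hK y hy]
    · simp only [hψ, if_neg hy, mul_zero]
  calc ∑ y : ↥i.R, Tk ⟨e x, hx⟩ y * (if einv y.1 ∈ S then f (einv y.1) else 0)
      = ∑ y : ↥i.R, ψ y.1 := Finset.sum_congr rfl fun y _ => hpt y
    _ = ∑ x' ∈ S, ψ (e x') := sum_subtype_eq_sum_of_support S e he hS ψ fun z _ hz => by
        have hzS : einv z ∉ S := fun hmem => hz (einv z) hmem (h2 z)
        simp only [hψ, if_neg hzS]
    _ = ∑ x' ∈ S, K x x' * f x' := Finset.sum_congr rfl fun x' hx' => by simp only [hψ, h1 x', if_pos hx']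

/-- **TRANSFER, `0 < t ≤ s` (`p ≤ q < ∞`)**: if the box kernel `Tk` maps `‖·‖_{1/s} → ‖·‖_{1/t}` with norm `≤ c` (b04's
`η`-weighted norms `lpN`), then its truncation to `e(Λ) × e(S)`, read on the lattice, obeys the same bound between the
`η`-weighted `ℓ^{1/s}(S)` and `ℓ^{1/t}(Λ)` functionals. [folklore] -/
private theorem transfer_pos (h1 : ∀ x, einv (e x) = x) (h2 : ∀ z, e (einv z) = z)
    (Tk : ↥i.R → ↥i.R → ℝ) (K : (Fin (d + 1) → ℤ) → (Fin (d + 1) → ℤ) → ℝ) (Λ : Finset (Fin (d + 1) → ℤ))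
    (hS : ∀ x ∈ S, e x ∈ i.R) (hΛ : ∀ x ∈ Λ, e x ∈ i.R)
    (hK : ∀ x (hx : x ∈ Λ) (y : ↥i.R), einv y.1 ∈ S → Tk ⟨e x, hΛ x hx⟩ y = K x (einv y.1))
    {c s t : ℝ} (hs : 0 < s) (ht : 0 < t)
    (hY : ∀ F g : ↥i.R → ℝ, (∀ y', g y' = ∑ y, Tk y' y * F y) → i.lpN t g ≤ c * i.lpN s F) :
    (((1 : ℝ) / i.n) ^ (d + 1) * ∑ x ∈ Λ, |∑ x' ∈ S, K x x' * f x'| ^ (1 / t)) ^ t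
      ≤ c * (((1 : ℝ) / i.n) ^ (d + 1) * ∑ x' ∈ S, |f x'| ^ (1 / s)) ^ s := by
  classical
  set F : ↥i.R → ℝ := fun y => if einv y.1 ∈ S then f (einv y.1) else 0 with hF
  set g : ↥i.R → ℝ := fun y' => ∑ y, Tk y' y * F y with hg
  have hYg : i.lpN t g ≤ c * i.lpN s F := hY F g fun _ => rfl
  have hw : 0 ≤ ((1 : ℝ) / i.n) ^ (d + 1) := by positivity
  have hsum : ∑ y, |F y| ^ (1 / s) = ∑ x' ∈ S, |f x'| ^ (1 / s) :=
    sum_moved_rpow i e einv S f h1 h2 hS (one_div_ne_zero hs.ne')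
  have hR : i.lpN s F = (((1 : ℝ) / i.n) ^ (d + 1) * ∑ x' ∈ S, |f x'| ^ (1 / s)) ^ s := by
    unfold ZeroFieldCube.lpN
    rw [if_neg hs.ne', hsum]
  have hGx : ∀ x : ↥Λ, g ⟨e x.1, hΛ x.1 x.2⟩ = ∑ x' ∈ S, K x.1 x' * f x' := fun x =>
    moved_apply i e einv S f h1 h2 hS Tk K (hΛ x.1 x.2) (hK x.1 x.2)
  have he : Function.Injective e := fun x y h => by rw [← h1 x, ← h1 y, h]
  have hL : (((1 : ℝ) / i.n) ^ (d + 1) * ∑ x ∈ Λ, |∑ x' ∈ S, K x x' * f x'| ^ (1 / t)) ^ t ≤ i.lpN t g := by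
    unfold ZeroFieldCube.lpN
    rw [if_neg ht.ne']
    refine Real.rpow_le_rpow (mul_nonneg hw (Finset.sum_nonneg fun _ _ => Real.rpow_nonneg (abs_nonneg _) _))
      (mul_le_mul_of_nonneg_left ?_ hw) ht.le
    set ι : ↥Λ → ↥i.R := fun x => ⟨e x.1, hΛ x.1 x.2⟩ with hι
    have hinj : Function.Injective ι := fun x₁ x₂ h => Subtype.ext (he (congrArg Subtype.val h))
    calc ∑ x ∈ Λ, |∑ x' ∈ S, K x x' * f x'| ^ (1 / t)
        = ∑ x ∈ Λ.attach, (fun y' => |g y'| ^ (1 / t)) (ι x) := by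
          rw [← Finset.sum_attach]
          exact Finset.sum_congr rfl fun x _ => by simp only [hι, hGx]
      _ ≤ ∑ y', (fun y' => |g y'| ^ (1 / t)) y' :=
          sum_attach_le_univ_sum Λ ι hinj _ fun _ => Real.rpow_nonneg (abs_nonneg _) _
  calc _ ≤ i.lpN t g := hL
    _ ≤ c * i.lpN s F := hYg
    _ = _ := by rw [hR]

/-- **TRANSFER, `t = 0 < s` (`p < q = ∞`)**: the same with the sup norm on the left, at one moved point. [folklore] -/
private theorem transfer_sup (h1 : ∀ x, einv (e x) = x) (h2 : ∀ z, e (einv z) = z)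
    (Tk : ↥i.R → ↥i.R → ℝ) (K : (Fin (d + 1) → ℤ) → (Fin (d + 1) → ℤ) → ℝ)
    (hS : ∀ x ∈ S, e x ∈ i.R) {x : Fin (d + 1) → ℤ} (hx : e x ∈ i.R)
    (hK : ∀ y : ↥i.R, einv y.1 ∈ S → Tk ⟨e x, hx⟩ y = K x (einv y.1))
    {c s : ℝ} (hs : 0 < s)
    (hY : ∀ F g : ↥i.R → ℝ, (∀ y', g y' = ∑ y, Tk y' y * F y) → i.lpN 0 g ≤ c * i.lpN s F) :
    |∑ x' ∈ S, K x x' * f x'| ≤ c * (((1 : ℝ) / i.n) ^ (d + 1) * ∑ x' ∈ S, |f x'| ^ (1 / s)) ^ s := by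
  classical
  set F : ↥i.R → ℝ := fun y => if einv y.1 ∈ S then f (einv y.1) else 0 with hF
  set g : ↥i.R → ℝ := fun y' => ∑ y, Tk y' y * F y with hg
  have hYg : i.lpN 0 g ≤ c * i.lpN s F := hY F g fun _ => rfl
  have hsum : ∑ y, |F y| ^ (1 / s) = ∑ x' ∈ S, |f x'| ^ (1 / s) :=
    sum_moved_rpow i e einv S f h1 h2 hS (one_div_ne_zero hs.ne')
  have hR : i.lpN s F = (((1 : ℝ) / i.n) ^ (d + 1) * ∑ x' ∈ S, |f x'| ^ (1 / s)) ^ s := by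
    unfold ZeroFieldCube.lpN
    rw [if_neg hs.ne', hsum]
  have hGx : g ⟨e x, hx⟩ = ∑ x' ∈ S, K x x' * f x' := moved_apply i e einv S f h1 h2 hS Tk K hx hK
  have hL : |∑ x' ∈ S, K x x' * f x'| ≤ i.lpN 0 g := by
    rw [← hGx]
    unfold ZeroFieldCube.lpN
    rw [if_pos rfl]
    exact abs_le_supN_cube i g _
  calc _ ≤ i.lpN 0 g := hL
    _ ≤ c * i.lpN s F := hYg
    _ = _ := by rw [hR]

/-- **TRANSFER, `t = s = 0` (`p = q = ∞`)**: the sup-to-sup bound at one moved point, for a datum bounded by `F_∞ ≥ 0` on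
`S`. [folklore] -/
private theorem transfer_supsup (h1 : ∀ x, einv (e x) = x) (h2 : ∀ z, e (einv z) = z)
    (Tk : ↥i.R → ↥i.R → ℝ) (K : (Fin (d + 1) → ℤ) → (Fin (d + 1) → ℤ) → ℝ)
    (hS : ∀ x ∈ S, e x ∈ i.R) {x : Fin (d + 1) → ℤ} (hx : e x ∈ i.R)
    (hK : ∀ y : ↥i.R, einv y.1 ∈ S → Tk ⟨e x, hx⟩ y = K x (einv y.1))
    {c Fsup : ℝ} (hc : 0 ≤ c) (hF0 : 0 ≤ Fsup) (hf : ∀ x' ∈ S, |f x'| ≤ Fsup)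
    (hY : ∀ F g : ↥i.R → ℝ, (∀ y', g y' = ∑ y, Tk y' y * F y) → i.lpN 0 g ≤ c * i.lpN 0 F) :
    |∑ x' ∈ S, K x x' * f x'| ≤ c * Fsup := by
  classical
  set F : ↥i.R → ℝ := fun y => if einv y.1 ∈ S then f (einv y.1) else 0 with hF
  set g : ↥i.R → ℝ := fun y' => ∑ y, Tk y' y * F y with hg
  have hYg : i.lpN 0 g ≤ c * i.lpN 0 F := hY F g fun _ => rfl
  have hR : i.lpN 0 F ≤ Fsup := by
    unfold ZeroFieldCube.lpN
    rw [if_pos rfl]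
    exact supN_moved_le i einv S f hF0 hf
  have hGx : g ⟨e x, hx⟩ = ∑ x' ∈ S, K x x' * f x' := moved_apply i e einv S f h1 h2 hS Tk K hx hK
  have hL : |∑ x' ∈ S, K x x' * f x'| ≤ i.lpN 0 g := by
    rw [← hGx]
    unfold ZeroFieldCube.lpN
    rw [if_pos rfl]
    exact abs_le_supN_cube i g _
  exact hL.trans (hYg.trans (mul_le_mul_of_nonneg_left hR hc))

end Transfer

/-! ## §2 From the centred cubes `C_T` to the lattice: the box theorem on every cube containing the data, then `T → ∞` -/

section Cubes

variable {ℓ k : ℕ} {a m2 m2plus : ℝ}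

/-- kernel: the limit step, `0 < t` — a bound for the truncated functional along the cubes passes to the limit kernel.
[folklore] -/
private theorem rpow_le_of_cubes {KT : ℕ → (Fin (d + 1) → ℤ) → (Fin (d + 1) → ℤ) → ℝ}
    {Klim : (Fin (d + 1) → ℤ) → (Fin (d + 1) → ℤ) → ℝ} (S Λ : Finset (Fin (d + 1) → ℤ)) (f : (Fin (d + 1) → ℤ) → ℝ)
    (hlim : ∀ x x', Tendsto (fun T => KT T x x') atTop (𝓝 (Klim x x'))) {w B t : ℝ} (ht : 0 < t) {R : ℕ}
    (hB : ∀ T, R ≤ T → (w * ∑ x ∈ Λ, |∑ x' ∈ S, KT T x x' * f x'| ^ (1 / t)) ^ t ≤ B) :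
    (w * ∑ x ∈ Λ, |∑ x' ∈ S, Klim x x' * f x'| ^ (1 / t)) ^ t ≤ B := by
  have hT : Tendsto (fun T => (w * ∑ x ∈ Λ, |∑ x' ∈ S, KT T x x' * f x'| ^ (1 / t)) ^ t) atTop
      (𝓝 ((w * ∑ x ∈ Λ, |∑ x' ∈ S, Klim x x' * f x'| ^ (1 / t)) ^ t)) := by
    refine ((tendsto_finsetSum Λ fun x _ => ?_).const_mul w).rpow_const (Or.inr ht.le)
    exact (tendsto_finsetSum S fun x' _ => (hlim x x').mul_const (f x')).abs.rpow_const
      (Or.inr (one_div_nonneg.2 ht.le))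
  exact le_of_tendsto hT (eventually_atTop.2 ⟨R, hB⟩)

/-- kernel: the limit step for one output point. [folklore] -/
private theorem abs_le_of_cubes {KT : ℕ → (Fin (d + 1) → ℤ) → (Fin (d + 1) → ℤ) → ℝ}
    {Klim : (Fin (d + 1) → ℤ) → (Fin (d + 1) → ℤ) → ℝ} (S : Finset (Fin (d + 1) → ℤ)) (f : (Fin (d + 1) → ℤ) → ℝ)
    (x : Fin (d + 1) → ℤ) (hlim : ∀ x', Tendsto (fun T => KT T x x') atTop (𝓝 (Klim x x'))) {B : ℝ} {R : ℕ}
    (hB : ∀ T, R ≤ T → |∑ x' ∈ S, KT T x x' * f x'| ≤ B) :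
    |∑ x' ∈ S, Klim x x' * f x'| ≤ B :=
  le_of_tendsto (tendsto_finsetSum S fun x' _ => (hlim x').mul_const (f x')).abs (eventually_atTop.2 ⟨R, hB⟩)

/-- kernel: memberships in the cube `C_T` of a finite set of points and of their `μ`-successors, for `T` beyond a
common label radius. [folklore] -/
private theorem exists_rad (n : ℕ) (hn : 1 ≤ n) (F : Finset (Fin (d + 1) → ℤ)) (μ : Fin (d + 1)) :
    ∃ R : ℕ, ∀ T, R ≤ T → ∀ z ∈ F, ctr n T z ∈ boxDom (fun i => n * cubeM (d := d) T i) ∧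
      ctr n T (z + Pi.single μ 1) ∈ boxDom (fun i => n * cubeM (d := d) T i) := by
  classical
  obtain ⟨R, hR⟩ := exists_labRad_finset n (F ∪ F.image (· + Pi.single μ 1))
  exact ⟨R, fun T hT z hz => ⟨ctr_mem (d := d) hn hT (hR z (Finset.mem_union_left _ hz)),
    ctr_mem (d := d) hn hT (hR _ (Finset.mem_union_right _ (Finset.mem_image_of_mem _ hz)))⟩⟩

/-- **THE LATTICE BOUND FROM THE BOX BOUNDS, `0 < t ≤ s`.**  Suppose the box kernels `T^{(m)}[G_k(C_T,0)]` (b-lineage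
`kerOf`, `m ∈ {0,1,2}`: value, row difference `D^η_μ`, column difference `D^{η*}_μ`) map `‖·‖_{1/s} → ‖·‖_{1/t}` with norm
`≤ c` on EVERY member of the zero-field box family at scale `k` and mass `m²`, that read at centred lattice points they are
the total kernels `K_T`, and that `K_T → K` pointwise as the cubes exhaust the lattice.  Then the truncated `η`-weighted
functional of `K` obeys the bound `c`. [folklore] -/
private theorem lattice_pos (hk : 1 ≤ k) (hm : 0 ≤ m2) (hm' : m2 ≤ m2plus) {c s t : ℝ} (hs : 0 < s) (ht : 0 < t)
    (m : Fin 3) (μ : Fin (d + 1))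
    (hY : ∀ (i : BoxInst d ℓ m2plus) (F g : ↥(toZFC i).R → ℝ),
      (∀ y', g y' = ∑ y, kerOf ((ℓ + 1) ^ i.k) m μ (Gfine ℓ i.k i.M i.k a i.m2) y' y * F y) →
        (toZFC i).lpN t g ≤ c * (toZFC i).lpN s F)
    {KT : ℕ → (Fin (d + 1) → ℤ) → (Fin (d + 1) → ℤ) → ℝ} {Klim : (Fin (d + 1) → ℤ) → (Fin (d + 1) → ℤ) → ℝ}
    (hKT : ∀ (T : ℕ) (x x' : Fin (d + 1) → ℤ) (hx : ctr ((ℓ + 1) ^ k) T x ∈ boxDom (Nf ℓ k (cubeM T)))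
      (_hxe : ctr ((ℓ + 1) ^ k) T (x + Pi.single μ 1) ∈ boxDom (Nf ℓ k (cubeM T)))
      (hx' : ctr ((ℓ + 1) ^ k) T x' ∈ boxDom (Nf ℓ k (cubeM T)))
      (_hx'e : ctr ((ℓ + 1) ^ k) T (x' + Pi.single μ 1) ∈ boxDom (Nf ℓ k (cubeM T))),
      kerOf ((ℓ + 1) ^ k) m μ (Gfine ℓ k (cubeM T) k a m2) ⟨_, hx⟩ ⟨_, hx'⟩ = KT T x x')
    (hlim : ∀ x x', Tendsto (fun T => KT T x x') atTop (𝓝 (Klim x x')))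
    (S Λ : Finset (Fin (d + 1) → ℤ)) (f : (Fin (d + 1) → ℤ) → ℝ) :
    (((1 : ℝ) / ((ℓ + 1) ^ k : ℕ)) ^ (d + 1) * ∑ x ∈ Λ, |∑ x' ∈ S, Klim x x' * f x'| ^ (1 / t)) ^ t
      ≤ c * (((1 : ℝ) / ((ℓ + 1) ^ k : ℕ)) ^ (d + 1) * ∑ x' ∈ S, |f x'| ^ (1 / s)) ^ s := by
  classical
  have hn := one_le_n ℓ k
  obtain ⟨R, hR⟩ := exists_rad ((ℓ + 1) ^ k) hn (Λ ∪ S) μ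
  refine rpow_le_of_cubes S Λ f hlim ht (R := R) fun T hT => ?_
  have hmem := hR T hT
  let i : BoxInst d ℓ m2plus := ⟨k, hk, cubeM T, cubeM_pos T, boxDom (Nf ℓ k (cubeM T)),
    boxDom_isBlockUnion hn (cubeM T), Finset.Subset.refl _, m2, hm, hm', 0⟩
  set v : Fin (d + 1) → ℤ := fun _ => ((((ℓ + 1) ^ k : ℕ)) : ℤ) * (T : ℤ) with hv
  have h1 : ∀ x : Fin (d + 1) → ℤ, ctr ((ℓ + 1) ^ k) T x - v = x := fun x => add_sub_cancel_right x v
  have h2 : ∀ z : Fin (d + 1) → ℤ, ctr ((ℓ + 1) ^ k) T (z - v) = z := fun z => sub_add_cancel z v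
  refine transfer_pos (toZFC i) (ctr ((ℓ + 1) ^ k) T) (fun z => z - v) S f h1 h2
    (kerOf ((ℓ + 1) ^ k) m μ (Gfine ℓ k (cubeM T) k a m2)) (KT T) Λ
    (fun x hx => (hmem x (Finset.mem_union_right _ hx)).1) (fun x hx => (hmem x (Finset.mem_union_left _ hx)).1)
    ?_ hs ht (hY i)
  intro x hx y hy
  obtain ⟨hx1, hxe1⟩ := hmem x (Finset.mem_union_left _ hx)
  obtain ⟨hy1, hye1⟩ := hmem (y.1 - v) (Finset.mem_union_right _ hy)
  have hyeq : y = ⟨ctr ((ℓ + 1) ^ k) T (y.1 - v), hy1⟩ := Subtype.ext (h2 y.1).symm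
  set x' : Fin (d + 1) → ℤ := y.1 - v with hx'
  rw [hyeq]
  exact hKT T x x' hx1 hxe1 hy1 hye1

/-- **THE LATTICE BOUND FROM THE BOX BOUNDS, `t = 0 < s`** (one output point). [folklore] -/
private theorem lattice_sup (hk : 1 ≤ k) (hm : 0 ≤ m2) (hm' : m2 ≤ m2plus) {c s : ℝ} (hs : 0 < s)
    (m : Fin 3) (μ : Fin (d + 1))
    (hY : ∀ (i : BoxInst d ℓ m2plus) (F g : ↥(toZFC i).R → ℝ),
      (∀ y', g y' = ∑ y, kerOf ((ℓ + 1) ^ i.k) m μ (Gfine ℓ i.k i.M i.k a i.m2) y' y * F y) →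
        (toZFC i).lpN 0 g ≤ c * (toZFC i).lpN s F)
    {KT : ℕ → (Fin (d + 1) → ℤ) → (Fin (d + 1) → ℤ) → ℝ} {Klim : (Fin (d + 1) → ℤ) → (Fin (d + 1) → ℤ) → ℝ}
    (hKT : ∀ (T : ℕ) (x x' : Fin (d + 1) → ℤ) (hx : ctr ((ℓ + 1) ^ k) T x ∈ boxDom (Nf ℓ k (cubeM T)))
      (_hxe : ctr ((ℓ + 1) ^ k) T (x + Pi.single μ 1) ∈ boxDom (Nf ℓ k (cubeM T)))
      (hx' : ctr ((ℓ + 1) ^ k) T x' ∈ boxDom (Nf ℓ k (cubeM T)))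
      (_hx'e : ctr ((ℓ + 1) ^ k) T (x' + Pi.single μ 1) ∈ boxDom (Nf ℓ k (cubeM T))),
      kerOf ((ℓ + 1) ^ k) m μ (Gfine ℓ k (cubeM T) k a m2) ⟨_, hx⟩ ⟨_, hx'⟩ = KT T x x')
    (hlim : ∀ x x', Tendsto (fun T => KT T x x') atTop (𝓝 (Klim x x')))
    (S : Finset (Fin (d + 1) → ℤ)) (f : (Fin (d + 1) → ℤ) → ℝ) (x : Fin (d + 1) → ℤ) :
    |∑ x' ∈ S, Klim x x' * f x'|
      ≤ c * (((1 : ℝ) / ((ℓ + 1) ^ k : ℕ)) ^ (d + 1) * ∑ x' ∈ S, |f x'| ^ (1 / s)) ^ s := by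
  classical
  have hn := one_le_n ℓ k
  obtain ⟨R, hR⟩ := exists_rad ((ℓ + 1) ^ k) hn ({x} ∪ S) μ
  refine abs_le_of_cubes S f x (hlim x) (R := R) fun T hT => ?_
  have hmem := hR T hT
  let i : BoxInst d ℓ m2plus := ⟨k, hk, cubeM T, cubeM_pos T, boxDom (Nf ℓ k (cubeM T)),
    boxDom_isBlockUnion hn (cubeM T), Finset.Subset.refl _, m2, hm, hm', 0⟩
  set v : Fin (d + 1) → ℤ := fun _ => ((((ℓ + 1) ^ k : ℕ)) : ℤ) * (T : ℤ) with hv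
  have h1 : ∀ x : Fin (d + 1) → ℤ, ctr ((ℓ + 1) ^ k) T x - v = x := fun x => add_sub_cancel_right x v
  have h2 : ∀ z : Fin (d + 1) → ℤ, ctr ((ℓ + 1) ^ k) T (z - v) = z := fun z => sub_add_cancel z v
  obtain ⟨hx1, hxe1⟩ := hmem x (Finset.mem_union_left _ (Finset.mem_singleton_self x))
  refine transfer_sup (toZFC i) (ctr ((ℓ + 1) ^ k) T) (fun z => z - v) S f h1 h2
    (kerOf ((ℓ + 1) ^ k) m μ (Gfine ℓ k (cubeM T) k a m2)) (KT T)
    (fun x hx => (hmem x (Finset.mem_union_right _ hx)).1) hx1 ?_ hs (hY i)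
  intro y hy
  obtain ⟨hy1, hye1⟩ := hmem (y.1 - v) (Finset.mem_union_right _ hy)
  have hyeq : y = ⟨ctr ((ℓ + 1) ^ k) T (y.1 - v), hy1⟩ := Subtype.ext (h2 y.1).symm
  set x' : Fin (d + 1) → ℤ := y.1 - v with hx'
  rw [hyeq]
  exact hKT T x x' hx1 hxe1 hy1 hye1

/-- **THE LATTICE BOUND FROM THE BOX BOUNDS, `t = s = 0`** (one output point, bounded datum on `S`). [folklore] -/
private theorem lattice_supsup (hk : 1 ≤ k) (hm : 0 ≤ m2) (hm' : m2 ≤ m2plus) {c : ℝ} (hc : 0 ≤ c)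
    (m : Fin 3) (μ : Fin (d + 1))
    (hY : ∀ (i : BoxInst d ℓ m2plus) (F g : ↥(toZFC i).R → ℝ),
      (∀ y', g y' = ∑ y, kerOf ((ℓ + 1) ^ i.k) m μ (Gfine ℓ i.k i.M i.k a i.m2) y' y * F y) →
        (toZFC i).lpN 0 g ≤ c * (toZFC i).lpN 0 F)
    {KT : ℕ → (Fin (d + 1) → ℤ) → (Fin (d + 1) → ℤ) → ℝ} {Klim : (Fin (d + 1) → ℤ) → (Fin (d + 1) → ℤ) → ℝ}
    (hKT : ∀ (T : ℕ) (x x' : Fin (d + 1) → ℤ) (hx : ctr ((ℓ + 1) ^ k) T x ∈ boxDom (Nf ℓ k (cubeM T)))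
      (_hxe : ctr ((ℓ + 1) ^ k) T (x + Pi.single μ 1) ∈ boxDom (Nf ℓ k (cubeM T)))
      (hx' : ctr ((ℓ + 1) ^ k) T x' ∈ boxDom (Nf ℓ k (cubeM T)))
      (_hx'e : ctr ((ℓ + 1) ^ k) T (x' + Pi.single μ 1) ∈ boxDom (Nf ℓ k (cubeM T))),
      kerOf ((ℓ + 1) ^ k) m μ (Gfine ℓ k (cubeM T) k a m2) ⟨_, hx⟩ ⟨_, hx'⟩ = KT T x x')
    (hlim : ∀ x x', Tendsto (fun T => KT T x x') atTop (𝓝 (Klim x x')))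
    (S : Finset (Fin (d + 1) → ℤ)) (f : (Fin (d + 1) → ℤ) → ℝ) {Fsup : ℝ} (hF0 : 0 ≤ Fsup)
    (hf : ∀ x' ∈ S, |f x'| ≤ Fsup) (x : Fin (d + 1) → ℤ) :
    |∑ x' ∈ S, Klim x x' * f x'| ≤ c * Fsup := by
  classical
  have hn := one_le_n ℓ k
  obtain ⟨R, hR⟩ := exists_rad ((ℓ + 1) ^ k) hn ({x} ∪ S) μ
  refine abs_le_of_cubes S f x (hlim x) (R := R) fun T hT => ?_
  have hmem := hR T hT
  let i : BoxInst d ℓ m2plus := ⟨k, hk, cubeM T, cubeM_pos T, boxDom (Nf ℓ k (cubeM T)),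
    boxDom_isBlockUnion hn (cubeM T), Finset.Subset.refl _, m2, hm, hm', 0⟩
  set v : Fin (d + 1) → ℤ := fun _ => ((((ℓ + 1) ^ k : ℕ)) : ℤ) * (T : ℤ) with hv
  have h1 : ∀ x : Fin (d + 1) → ℤ, ctr ((ℓ + 1) ^ k) T x - v = x := fun x => add_sub_cancel_right x v
  have h2 : ∀ z : Fin (d + 1) → ℤ, ctr ((ℓ + 1) ^ k) T (z - v) = z := fun z => sub_add_cancel z v
  obtain ⟨hx1, hxe1⟩ := hmem x (Finset.mem_union_left _ (Finset.mem_singleton_self x))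
  refine transfer_supsup (toZFC i) (ctr ((ℓ + 1) ^ k) T) (fun z => z - v) S f h1 h2
    (kerOf ((ℓ + 1) ^ k) m μ (Gfine ℓ k (cubeM T) k a m2)) (KT T)
    (fun x hx => (hmem x (Finset.mem_union_right _ hx)).1) hx1 ?_ hc hF0 hf (hY i)
  intro y hy
  obtain ⟨hy1, hye1⟩ := hmem (y.1 - v) (Finset.mem_union_right _ hy)
  have hyeq : y = ⟨ctr ((ℓ + 1) ^ k) T (y.1 - v), hy1⟩ := Subtype.ext (h2 y.1).symm
  set x' : Fin (d + 1) → ℤ := y.1 - v with hx'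
  rw [hyeq]
  exact hKT T x x' hx1 hxe1 hy1 hye1

/-! ### The three box kernels read at centred lattice points are the cube propagators `g_T` of `B3GkZeroLattice` -/

/-- kernel (`m = 0`): the value kernel of `G_k(C_T,0)` at centred points is `g_T(x,x′)`. [folklore] -/
private theorem kerOf_cube_val (μ : Fin (d + 1)) (T : ℕ) (x x' : Fin (d + 1) → ℤ)
    (hx : ctr ((ℓ + 1) ^ k) T x ∈ boxDom (Nf ℓ k (cubeM T)))
    (_hxe : ctr ((ℓ + 1) ^ k) T (x + Pi.single μ 1) ∈ boxDom (Nf ℓ k (cubeM T)))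
    (hx' : ctr ((ℓ + 1) ^ k) T x' ∈ boxDom (Nf ℓ k (cubeM T)))
    (_hx'e : ctr ((ℓ + 1) ^ k) T (x' + Pi.single μ 1) ∈ boxDom (Nf ℓ k (cubeM T))) :
    kerOf ((ℓ + 1) ^ k) 0 μ (Gfine ℓ k (cubeM T) k a m2) ⟨_, hx⟩ ⟨_, hx'⟩ = gcube ℓ k T a m2 x x' := by
  rw [kerOf, if_pos rfl, gcube_eq hx hx']

/-- kernel: the forward neighbour of a centred point whose successor is centred in the box. [folklore] -/
private theorem fwd_ctr (μ : Fin (d + 1)) (T : ℕ) (x : Fin (d + 1) → ℤ)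
    (hx : ctr ((ℓ + 1) ^ k) T x ∈ boxDom (Nf ℓ k (cubeM T)))
    (hxe : ctr ((ℓ + 1) ^ k) T (x + Pi.single μ 1) ∈ boxDom (Nf ℓ k (cubeM T))) :
    fwd (Nf ℓ k (cubeM T)) μ ⟨_, hx⟩ = ⟨_, hxe⟩ := by
  have h : ctr ((ℓ + 1) ^ k) T x + Pi.single μ 1 ∈ boxDom (Nf ℓ k (cubeM (d := d) T)) := by
    rw [← ctr_add_single]; exact hxe
  apply Subtype.ext
  rw [fwd_val_of_mem μ _ h]
  exact (ctr_add_single _ T x μ).symm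

/-- kernel (`m = 1`): the row-differenced kernel `D^η_μG_k(C_T,0)` at centred points is `n(g_T(x+e_μ,x′) − g_T(x,x′))`.
[folklore] -/
private theorem kerOf_cube_row (μ : Fin (d + 1)) (T : ℕ) (x x' : Fin (d + 1) → ℤ)
    (hx : ctr ((ℓ + 1) ^ k) T x ∈ boxDom (Nf ℓ k (cubeM T)))
    (hxe : ctr ((ℓ + 1) ^ k) T (x + Pi.single μ 1) ∈ boxDom (Nf ℓ k (cubeM T)))
    (hx' : ctr ((ℓ + 1) ^ k) T x' ∈ boxDom (Nf ℓ k (cubeM T)))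
    (_hx'e : ctr ((ℓ + 1) ^ k) T (x' + Pi.single μ 1) ∈ boxDom (Nf ℓ k (cubeM T))) :
    kerOf ((ℓ + 1) ^ k) 1 μ (Gfine ℓ k (cubeM T) k a m2) ⟨_, hx⟩ ⟨_, hx'⟩
      = (((ℓ + 1) ^ k : ℕ) : ℝ) * (gcube ℓ k T a m2 (x + Pi.single μ 1) x' - gcube ℓ k T a m2 x x') := by
  rw [kerOf, if_neg (by decide), if_pos rfl]
  show (((ℓ + 1) ^ k : ℕ) : ℝ) * (Gfine ℓ k (cubeM T) k a m2 (fwd (Nf ℓ k (cubeM T)) μ ⟨_, hx⟩) ⟨_, hx'⟩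
    - Gfine ℓ k (cubeM T) k a m2 ⟨_, hx⟩ ⟨_, hx'⟩) = _
  rw [fwd_ctr μ T x hx hxe, gcube_eq hxe hx', gcube_eq hx hx']

/-- kernel (`m = 2`): the column-differenced kernel `G_k(C_T,0)D^{η*}_μ` at centred points is `n(g_T(x,x′+e_μ) − g_T(x,x′))`.
[folklore] -/
private theorem kerOf_cube_col (μ : Fin (d + 1)) (T : ℕ) (x x' : Fin (d + 1) → ℤ)
    (hx : ctr ((ℓ + 1) ^ k) T x ∈ boxDom (Nf ℓ k (cubeM T)))
    (_hxe : ctr ((ℓ + 1) ^ k) T (x + Pi.single μ 1) ∈ boxDom (Nf ℓ k (cubeM T)))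
    (hx' : ctr ((ℓ + 1) ^ k) T x' ∈ boxDom (Nf ℓ k (cubeM T)))
    (hx'e : ctr ((ℓ + 1) ^ k) T (x' + Pi.single μ 1) ∈ boxDom (Nf ℓ k (cubeM T))) :
    kerOf ((ℓ + 1) ^ k) 2 μ (Gfine ℓ k (cubeM T) k a m2) ⟨_, hx⟩ ⟨_, hx'⟩
      = (((ℓ + 1) ^ k : ℕ) : ℝ) * (gcube ℓ k T a m2 x (x' + Pi.single μ 1) - gcube ℓ k T a m2 x x') := by
  rw [kerOf, if_neg (by decide), if_neg (by decide)]
  show (((ℓ + 1) ^ k : ℕ) : ℝ) * (Gfine ℓ k (cubeM T) k a m2 ⟨_, hx⟩ (fwd (Nf ℓ k (cubeM T)) μ ⟨_, hx'⟩)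
    - Gfine ℓ k (cubeM T) k a m2 ⟨_, hx⟩ ⟨_, hx'⟩) = _
  rw [fwd_ctr μ T x' hx' hx'e, gcube_eq hx hx'e, gcube_eq hx hx']

end Cubes

/-! ## §3 Lemma 2.2 (2.17) for `G_k(0)` on `ηℤ^{d+1}`, `A = 0`: every `1 ≤ p ≤ q ≤ ∞` with `1/p − 1/q ≤ 1/p₁`, `p₁ > d+1` -/

section Main

variable {ℓ : ℕ}

/-- kernel: the exponent bookkeeping of the parallelogram (`s − 1/p₁ ≤ t`, `p₁ > d + 1`) against the
hypotheses of `Gfine_lpN_bound` at `e = (d+1)/p₁ − 1`. [folklore] -/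
private theorem exponents {p₁ s t : ℝ} (hp : (d : ℝ) + 1 < p₁) (hpt : s - 1 / p₁ ≤ t) :
    s - t < 1 ∧ ((d : ℝ) + 1) * (s - t) - 1 ≤ ((d : ℝ) + 1) / p₁ - 1 := by
  have hD : (0 : ℝ) < (d : ℝ) + 1 := by positivity
  have hp0 : 0 < p₁ := hD.trans hp
  have hp1 : 1 / p₁ < 1 := by rw [div_lt_one hp0]; linarith
  have h1 : s - t ≤ 1 / p₁ := by linarith
  refine ⟨by linarith, ?_⟩
  have h2 := mul_le_mul_of_nonneg_left h1 hD.le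
  rw [mul_one_div] at h2
  linarith

/-- **THE CONSTANT.**  For `p₁ > d + 1` and a coefficient window there is ONE `c₂ > 0` bounding all three box kernels of
`𝒢_k = G_k(□,0)` (running coefficient) between b04's `η`-weighted norms, on every member of the zero-field box family,
for all `0 ≤ t ≤ s ≤ 1` with `s − 1/p₁ ≤ t` — `B4Lemma22ZeroBoxLpLq.Gfine_lpN_bound` at the top scale.
[cite: Balaban1983RegularityDecay, Lemma 2.2 (2.17) p.578 via (2.40)–(2.41) p.583, case Ã = 0, □ a box] -/
private theorem box_constant (d ℓ : ℕ) (hℓ : 1 ≤ ℓ) (amin aplus m2plus : ℝ) (ha : 0 < amin) (p₁ : ℝ)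
    (hp : (d : ℝ) + 1 < p₁) :
    ∃ c₂ : ℝ, 0 < c₂ ∧ ∀ (i : BoxInst d ℓ m2plus) (a : ℝ), amin ≤ a → a ≤ aplus →
      ∀ (m : Fin 3) (μ : Fin (d + 1)) (s t : ℝ), 0 ≤ t → t ≤ s → s ≤ 1 → s - 1 / p₁ ≤ t →
      ∀ (F g : ↥(toZFC i).R → ℝ),
        (∀ y', g y' = ∑ y, kerOf ((ℓ + 1) ^ i.k) m μ (Gfine ℓ i.k i.M i.k a i.m2) y' y * F y) →
          (toZFC i).lpN t g ≤ c₂ * (toZFC i).lpN s F := by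
  have hD : (0 : ℝ) < (d : ℝ) + 1 := by positivity
  have he0 : ((d : ℝ) + 1) / p₁ - 1 < 0 := by
    rw [sub_neg, div_lt_one (hD.trans hp)]
    exact hp
  obtain ⟨c, hc, h⟩ := Gfine_lpN_bound (d := d) (m2plus := m2plus) hℓ amin aplus ha he0
  refine ⟨c + 1, by linarith, fun i a h1 h2 m μ s t ht hts hs1 hpt F g hg => ?_⟩
  obtain ⟨hst, hex⟩ := exponents (d := d) hp hpt
  exact (h i a h1 h2 i.k i.hk le_rfl m μ F g hg s t ht hts hs1 hst hex).trans
    (mul_le_mul_of_nonneg_right (by linarith) (lpN_nonneg _ _ _))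

/-- **B4 LEMMA 2.2 (2.17) FOR `□ ↦ ηℤ^{d+1}`, `A = 0` — THE OPERATOR `G_k(0)`, ALL `1 ≤ p ≤ q < ∞` WITH
`1/p − 1/q ≤ 1/p₁`, `p₁ > d + 1`** (`s = 1/p`, `t = 1/q`; finitely supported data, finite output windows).  There is
`c₂ > 0` (depending on `d`, `L = ℓ+1`, the window and `p₁` only) such that for every `k ≥ 1` (`η = L^{−k}`, `n = L^k`),
`a ∈ [a₋,a₊]`, `m² ∈ [0,m²₊]`, all `0 < t ≤ s ≤ 1` with `s − 1/p₁ ≤ t`, every finite `S, Λ ⊂ ℤ^{d+1}` and every `f`: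
`(η^{d+1}Σ_{x∈Λ}|Σ_{x′∈S}G_k(0)(x,x′)f(x′)|^{1/t})^t ≤ c₂(η^{d+1}Σ_{x′∈S}|f(x′)|^{1/s})^s`, i.e. `‖G_k(0)f‖_q ≤ c₂‖f‖_p` in the
`η`-weighted norms of (2.11) — the box theorem `B4Lemma22ZeroBoxLpLq.Gfine_lpN_bound` (kernel Young per scale of (2.40),
summed as in (2.41): «The Riesz-Thorin Theorem gives us finally (2.17) for G_k(□) and for all p, q described in the figure»)
on the centred cubes `C_T ⊃ Λ ∪ S` of `B3GkZeroLattice`, in the limit `T → ∞` (`tendsto_gcube`); p. 584: «This part of the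
argument is valid for an arbitrary rectangular parallelepiped □ built of unit blocks».
[cite: Balaban1983RegularityDecay, Lemma 2.2 (2.17) p.578; proof (2.40)–(2.41) p.583; dictionary (□ ↦ ηℤ^{d+1}, A = 0, p₁ > d ↦ p₁ > d+1 = the lattice dimension)] -/
theorem GkLat_lpq_le (d ℓ : ℕ) (hℓ : 1 ≤ ℓ) (amin aplus m2plus : ℝ) (ha : 0 < amin) (p₁ : ℝ)
    (hp : (d : ℝ) + 1 < p₁) :
    ∃ c₂ : ℝ, 0 < c₂ ∧ ∀ (k : ℕ), 1 ≤ k → ∀ (a m2 : ℝ), amin ≤ a → a ≤ aplus → 0 ≤ m2 → m2 ≤ m2plus →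
      ∀ (s t : ℝ), 0 < t → t ≤ s → s ≤ 1 → s - 1 / p₁ ≤ t →
      ∀ (S Λ : Finset (Fin (d + 1) → ℤ)) (f : (Fin (d + 1) → ℤ) → ℝ),
        (((1 : ℝ) / ((ℓ + 1) ^ k : ℕ)) ^ (d + 1) * ∑ x ∈ Λ, |∑ x' ∈ S, GkLat ℓ k a m2 x x' * f x'| ^ (1 / t)) ^ t
          ≤ c₂ * (((1 : ℝ) / ((ℓ + 1) ^ k : ℕ)) ^ (d + 1) * ∑ x' ∈ S, |f x'| ^ (1 / s)) ^ s := by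
  obtain ⟨c₂, hc₂, h⟩ := box_constant d ℓ hℓ amin aplus m2plus ha p₁ hp
  refine ⟨c₂, hc₂, fun k hk a m2 h1 h2 h3 h4 s t ht hts hs1 hpt S Λ f => ?_⟩
  have ha0 : 0 < a := ha.trans_le h1
  have _i : Inhabited (Fin (d + 1)) := ⟨0⟩
  exact lattice_pos (m2plus := m2plus) hk h3 h4 (lt_of_lt_of_le ht hts) ht 0 default
    (fun i F g hg => h i a h1 h2 0 default s t ht.le hts hs1 hpt F g hg)
    (KT := fun T x x' => gcube ℓ k T a m2 x x') (kerOf_cube_val (a := a) (m2 := m2) default)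
    (fun x x' => tendsto_gcube hℓ hk ha0 h3 x x') S Λ f

/-- **(2.17) FOR `□ ↦ ηℤ^{d+1}`, `A = 0` — THE OPERATOR `D^η_μG_k(0)`, ALL `1 ≤ p ≤ q < ∞` WITH `1/p − 1/q ≤ 1/p₁`,
`p₁ > d + 1`**: the same bound for the kernel `n(G_k(0)(x+e_μ,x′) − G_k(0)(x,x′))` of `∂^η_μG_k(0)` (fine units,
`∂^η_μ = n·(shift − 1)`), every axis `μ`. [cite: Balaban1983RegularityDecay, Lemma 2.2 (2.17) p.578 (second operator); proof p.583; dictionary (□ ↦ ηℤ^{d+1}, A = 0)] -/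
theorem GkLatD_lpq_le (d ℓ : ℕ) (hℓ : 1 ≤ ℓ) (amin aplus m2plus : ℝ) (ha : 0 < amin) (p₁ : ℝ)
    (hp : (d : ℝ) + 1 < p₁) :
    ∃ c₂ : ℝ, 0 < c₂ ∧ ∀ (k : ℕ), 1 ≤ k → ∀ (a m2 : ℝ), amin ≤ a → a ≤ aplus → 0 ≤ m2 → m2 ≤ m2plus →
      ∀ (μ : Fin (d + 1)) (s t : ℝ), 0 < t → t ≤ s → s ≤ 1 → s - 1 / p₁ ≤ t →
      ∀ (S Λ : Finset (Fin (d + 1) → ℤ)) (f : (Fin (d + 1) → ℤ) → ℝ),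
        (((1 : ℝ) / ((ℓ + 1) ^ k : ℕ)) ^ (d + 1) * ∑ x ∈ Λ, |∑ x' ∈ S, ((((ℓ + 1) ^ k : ℕ) : ℝ) *
            (GkLat ℓ k a m2 (x + Pi.single μ 1) x' - GkLat ℓ k a m2 x x')) * f x'| ^ (1 / t)) ^ t
          ≤ c₂ * (((1 : ℝ) / ((ℓ + 1) ^ k : ℕ)) ^ (d + 1) * ∑ x' ∈ S, |f x'| ^ (1 / s)) ^ s := by
  obtain ⟨c₂, hc₂, h⟩ := box_constant d ℓ hℓ amin aplus m2plus ha p₁ hp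
  refine ⟨c₂, hc₂, fun k hk a m2 h1 h2 h3 h4 μ s t ht hts hs1 hpt S Λ f => ?_⟩
  have ha0 : 0 < a := ha.trans_le h1
  exact lattice_pos (m2plus := m2plus) hk h3 h4 (lt_of_lt_of_le ht hts) ht 1 μ
    (fun i F g hg => h i a h1 h2 1 μ s t ht.le hts hs1 hpt F g hg)
    (KT := fun T x x' => (((ℓ + 1) ^ k : ℕ) : ℝ) * (gcube ℓ k T a m2 (x + Pi.single μ 1) x' - gcube ℓ k T a m2 x x'))
    (kerOf_cube_row (a := a) (m2 := m2) μ)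
    (fun x x' => ((tendsto_gcube hℓ hk ha0 h3 _ x').sub (tendsto_gcube hℓ hk ha0 h3 x x')).const_mul _) S Λ f

/-- **(2.17) FOR `□ ↦ ηℤ^{d+1}`, `A = 0` — THE OPERATOR `G_k(0)D^{η*}_μ`, ALL `1 ≤ p ≤ q < ∞` WITH `1/p − 1/q ≤ 1/p₁`,
`p₁ > d + 1`**: the same bound for the kernel `n(G_k(0)(x,x′+e_μ) − G_k(0)(x,x′))` of `G_k(0)∂^{η*}_μ` («by the duality
argument», p. 583: the transposed kernel). [cite: Balaban1983RegularityDecay, Lemma 2.2 (2.17) p.578 (third operator); proof p.583; dictionary (□ ↦ ηℤ^{d+1}, A = 0)] -/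
theorem GkLatDadj_lpq_le (d ℓ : ℕ) (hℓ : 1 ≤ ℓ) (amin aplus m2plus : ℝ) (ha : 0 < amin) (p₁ : ℝ)
    (hp : (d : ℝ) + 1 < p₁) :
    ∃ c₂ : ℝ, 0 < c₂ ∧ ∀ (k : ℕ), 1 ≤ k → ∀ (a m2 : ℝ), amin ≤ a → a ≤ aplus → 0 ≤ m2 → m2 ≤ m2plus →
      ∀ (μ : Fin (d + 1)) (s t : ℝ), 0 < t → t ≤ s → s ≤ 1 → s - 1 / p₁ ≤ t →
      ∀ (S Λ : Finset (Fin (d + 1) → ℤ)) (f : (Fin (d + 1) → ℤ) → ℝ),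
        (((1 : ℝ) / ((ℓ + 1) ^ k : ℕ)) ^ (d + 1) * ∑ x ∈ Λ, |∑ x' ∈ S, ((((ℓ + 1) ^ k : ℕ) : ℝ) *
            (GkLat ℓ k a m2 x (x' + Pi.single μ 1) - GkLat ℓ k a m2 x x')) * f x'| ^ (1 / t)) ^ t
          ≤ c₂ * (((1 : ℝ) / ((ℓ + 1) ^ k : ℕ)) ^ (d + 1) * ∑ x' ∈ S, |f x'| ^ (1 / s)) ^ s := by
  obtain ⟨c₂, hc₂, h⟩ := box_constant d ℓ hℓ amin aplus m2plus ha p₁ hp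
  refine ⟨c₂, hc₂, fun k hk a m2 h1 h2 h3 h4 μ s t ht hts hs1 hpt S Λ f => ?_⟩
  have ha0 : 0 < a := ha.trans_le h1
  exact lattice_pos (m2plus := m2plus) hk h3 h4 (lt_of_lt_of_le ht hts) ht 2 μ
    (fun i F g hg => h i a h1 h2 2 μ s t ht.le hts hs1 hpt F g hg)
    (KT := fun T x x' => (((ℓ + 1) ^ k : ℕ) : ℝ) * (gcube ℓ k T a m2 x (x' + Pi.single μ 1) - gcube ℓ k T a m2 x x'))
    (kerOf_cube_col (a := a) (m2 := m2) μ)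
    (fun x x' => ((tendsto_gcube hℓ hk ha0 h3 x _).sub (tendsto_gcube hℓ hk ha0 h3 x x')).const_mul _) S Λ f

/-! ### `q = ∞`: the bounds (2.41) `L^p → L^∞` for `p ≥ p₁`, and the corner `p = q = ∞`, all three operators -/

/-- kernel: `0 < 1/p₁ < 1` for `p₁ > d + 1`. [folklore] -/
private theorem inv_p₁_bounds {p₁ : ℝ} (hp : (d : ℝ) + 1 < p₁) : 0 < 1 / p₁ ∧ 1 / p₁ < 1 := by
  have hD : (0 : ℝ) < (d : ℝ) + 1 := by positivity
  have hp0 : 0 < p₁ := hD.trans hp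
  exact ⟨one_div_pos.2 hp0, by rw [div_lt_one hp0]; linarith⟩

/-- **(2.17) AT `q = ∞`, `p ≥ p₁` — (2.41) FOR `□ ↦ ηℤ^{d+1}`, `A = 0`, THE OPERATOR `G_k(0)`**: with the constant of
`GkLat_lpq_le`'s source, for every `k ≥ 1`, window point, `0 < s ≤ 1/p₁` (`s = 1/p`), finite `S`, every `f` and every
point `x`: `|Σ_{x′∈S}G_k(0)(x,x′)f(x′)| ≤ c₂(η^{d+1}Σ_{x′∈S}|f(x′)|^{1/s})^s` — «the operators G_k(□), ∂^η_μG_k(□), G_k(□)∂^{η*}_μ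
are bounded operators from L^{p₁}(□) with p₁ > d to L^∞(□)» (2.41), on the lattice.
[cite: Balaban1983RegularityDecay, (2.41) p.583 with Lemma 2.2 (2.17) p.578; dictionary (□ ↦ ηℤ^{d+1}, A = 0, p₁ > d+1)] -/
theorem GkLat_sup_lp_le (d ℓ : ℕ) (hℓ : 1 ≤ ℓ) (amin aplus m2plus : ℝ) (ha : 0 < amin) (p₁ : ℝ)
    (hp : (d : ℝ) + 1 < p₁) :
    ∃ c₂ : ℝ, 0 < c₂ ∧ ∀ (k : ℕ), 1 ≤ k → ∀ (a m2 : ℝ), amin ≤ a → a ≤ aplus → 0 ≤ m2 → m2 ≤ m2plus →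
      ∀ (s : ℝ), 0 < s → s ≤ 1 / p₁ → ∀ (S : Finset (Fin (d + 1) → ℤ)) (f : (Fin (d + 1) → ℤ) → ℝ) (x : Fin (d + 1) → ℤ),
        |∑ x' ∈ S, GkLat ℓ k a m2 x x' * f x'|
          ≤ c₂ * (((1 : ℝ) / ((ℓ + 1) ^ k : ℕ)) ^ (d + 1) * ∑ x' ∈ S, |f x'| ^ (1 / s)) ^ s := by
  obtain ⟨c₂, hc₂, h⟩ := box_constant d ℓ hℓ amin aplus m2plus ha p₁ hp
  obtain ⟨-, hp1⟩ := inv_p₁_bounds (d := d) hp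
  refine ⟨c₂, hc₂, fun k hk a m2 h1 h2 h3 h4 s hs hsp S f x => ?_⟩
  have ha0 : 0 < a := ha.trans_le h1
  have _i : Inhabited (Fin (d + 1)) := ⟨0⟩
  exact lattice_sup (m2plus := m2plus) hk h3 h4 hs 0 default
    (fun i F g hg => h i a h1 h2 0 default s 0 le_rfl hs.le (by linarith) (by linarith) F g hg)
    (KT := fun T x x' => gcube ℓ k T a m2 x x') (kerOf_cube_val (a := a) (m2 := m2) default)
    (fun x x' => tendsto_gcube hℓ hk ha0 h3 x x') S f x

/-- **(2.41) FOR `□ ↦ ηℤ^{d+1}`, `A = 0`, THE OPERATOR `D^η_μG_k(0)`** (`q = ∞`, `p ≥ p₁ > d + 1`).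
[cite: Balaban1983RegularityDecay, (2.41) p.583 with Lemma 2.2 (2.17) p.578 (second operator); dictionary (□ ↦ ηℤ^{d+1}, A = 0)] -/
theorem GkLatD_sup_lp_le (d ℓ : ℕ) (hℓ : 1 ≤ ℓ) (amin aplus m2plus : ℝ) (ha : 0 < amin) (p₁ : ℝ)
    (hp : (d : ℝ) + 1 < p₁) :
    ∃ c₂ : ℝ, 0 < c₂ ∧ ∀ (k : ℕ), 1 ≤ k → ∀ (a m2 : ℝ), amin ≤ a → a ≤ aplus → 0 ≤ m2 → m2 ≤ m2plus →
      ∀ (μ : Fin (d + 1)) (s : ℝ), 0 < s → s ≤ 1 / p₁ →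
      ∀ (S : Finset (Fin (d + 1) → ℤ)) (f : (Fin (d + 1) → ℤ) → ℝ) (x : Fin (d + 1) → ℤ),
        |∑ x' ∈ S, ((((ℓ + 1) ^ k : ℕ) : ℝ) * (GkLat ℓ k a m2 (x + Pi.single μ 1) x' - GkLat ℓ k a m2 x x')) * f x'|
          ≤ c₂ * (((1 : ℝ) / ((ℓ + 1) ^ k : ℕ)) ^ (d + 1) * ∑ x' ∈ S, |f x'| ^ (1 / s)) ^ s := by
  obtain ⟨c₂, hc₂, h⟩ := box_constant d ℓ hℓ amin aplus m2plus ha p₁ hp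
  obtain ⟨-, hp1⟩ := inv_p₁_bounds (d := d) hp
  refine ⟨c₂, hc₂, fun k hk a m2 h1 h2 h3 h4 μ s hs hsp S f x => ?_⟩
  have ha0 : 0 < a := ha.trans_le h1
  exact lattice_sup (m2plus := m2plus) hk h3 h4 hs 1 μ
    (fun i F g hg => h i a h1 h2 1 μ s 0 le_rfl hs.le (by linarith) (by linarith) F g hg)
    (KT := fun T x x' => (((ℓ + 1) ^ k : ℕ) : ℝ) * (gcube ℓ k T a m2 (x + Pi.single μ 1) x' - gcube ℓ k T a m2 x x'))
    (kerOf_cube_row (a := a) (m2 := m2) μ)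
    (fun x x' => ((tendsto_gcube hℓ hk ha0 h3 _ x').sub (tendsto_gcube hℓ hk ha0 h3 x x')).const_mul _) S f x

/-- **(2.41) FOR `□ ↦ ηℤ^{d+1}`, `A = 0`, THE OPERATOR `G_k(0)D^{η*}_μ`** (`q = ∞`, `p ≥ p₁ > d + 1`) — the operator of the
printed display (2.40). [cite: Balaban1983RegularityDecay, (2.40)–(2.41) p.583 with Lemma 2.2 (2.17) p.578 (third operator); dictionary (□ ↦ ηℤ^{d+1}, A = 0)] -/
theorem GkLatDadj_sup_lp_le (d ℓ : ℕ) (hℓ : 1 ≤ ℓ) (amin aplus m2plus : ℝ) (ha : 0 < amin) (p₁ : ℝ)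
    (hp : (d : ℝ) + 1 < p₁) :
    ∃ c₂ : ℝ, 0 < c₂ ∧ ∀ (k : ℕ), 1 ≤ k → ∀ (a m2 : ℝ), amin ≤ a → a ≤ aplus → 0 ≤ m2 → m2 ≤ m2plus →
      ∀ (μ : Fin (d + 1)) (s : ℝ), 0 < s → s ≤ 1 / p₁ →
      ∀ (S : Finset (Fin (d + 1) → ℤ)) (f : (Fin (d + 1) → ℤ) → ℝ) (x : Fin (d + 1) → ℤ),
        |∑ x' ∈ S, ((((ℓ + 1) ^ k : ℕ) : ℝ) * (GkLat ℓ k a m2 x (x' + Pi.single μ 1) - GkLat ℓ k a m2 x x')) * f x'|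
          ≤ c₂ * (((1 : ℝ) / ((ℓ + 1) ^ k : ℕ)) ^ (d + 1) * ∑ x' ∈ S, |f x'| ^ (1 / s)) ^ s := by
  obtain ⟨c₂, hc₂, h⟩ := box_constant d ℓ hℓ amin aplus m2plus ha p₁ hp
  obtain ⟨-, hp1⟩ := inv_p₁_bounds (d := d) hp
  refine ⟨c₂, hc₂, fun k hk a m2 h1 h2 h3 h4 μ s hs hsp S f x => ?_⟩
  have ha0 : 0 < a := ha.trans_le h1
  exact lattice_sup (m2plus := m2plus) hk h3 h4 hs 2 μ
    (fun i F g hg => h i a h1 h2 2 μ s 0 le_rfl hs.le (by linarith) (by linarith) F g hg)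
    (KT := fun T x x' => (((ℓ + 1) ^ k : ℕ) : ℝ) * (gcube ℓ k T a m2 x (x' + Pi.single μ 1) - gcube ℓ k T a m2 x x'))
    (kerOf_cube_col (a := a) (m2 := m2) μ)
    (fun x x' => ((tendsto_gcube hℓ hk ha0 h3 x _).sub (tendsto_gcube hℓ hk ha0 h3 x x')).const_mul _) S f x

/-- **(2.17) AT THE CORNER `p = q = ∞` FOR `□ ↦ ηℤ^{d+1}`, `A = 0` — ALL THREE OPERATORS ON FINITELY SUPPORTED BOUNDED DATA**
(`m = 0`: `G_k(0)`; `m = 1`: `∂^η_μG_k(0)`; `m = 2`: `G_k(0)∂^{η*}_μ`; the weights `η^{(d+1)/p}` cancel): with one `c₂`,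
`|Σ_{x′∈S}K^{(m)}(x,x′)f(x′)| ≤ c₂·F_∞` whenever `|f| ≤ F_∞` on `S` (`F_∞ ≥ 0`) — «For q = p = ∞, it is a special case of
(2.16)» (the value and `∂^η_μ` cases with their exponential weights are `B4Thm110ZeroLattice.GkLat_apply_le`,
`B4Thm19ZeroLattice.GkLatD_apply_le`; the `G_k(0)∂^{η*}_μ` case is new on the lattice).
[cite: Balaban1983RegularityDecay, Lemma 2.2 (2.17) p.578, corner q = p = ∞; proof p.583; dictionary (□ ↦ ηℤ^{d+1}, A = 0)] -/
theorem GkLat_three_sup_le (d ℓ : ℕ) (hℓ : 1 ≤ ℓ) (amin aplus m2plus : ℝ) (ha : 0 < amin) :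
    ∃ c₂ : ℝ, 0 < c₂ ∧ ∀ (k : ℕ), 1 ≤ k → ∀ (a m2 : ℝ), amin ≤ a → a ≤ aplus → 0 ≤ m2 → m2 ≤ m2plus →
      ∀ (μ : Fin (d + 1)) (S : Finset (Fin (d + 1) → ℤ)) (f : (Fin (d + 1) → ℤ) → ℝ) (Fsup : ℝ), 0 ≤ Fsup →
        (∀ x' ∈ S, |f x'| ≤ Fsup) → ∀ (x : Fin (d + 1) → ℤ),
        |∑ x' ∈ S, GkLat ℓ k a m2 x x' * f x'| ≤ c₂ * Fsup ∧
        |∑ x' ∈ S, ((((ℓ + 1) ^ k : ℕ) : ℝ) * (GkLat ℓ k a m2 (x + Pi.single μ 1) x' - GkLat ℓ k a m2 x x')) * f x'|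
          ≤ c₂ * Fsup ∧
        |∑ x' ∈ S, ((((ℓ + 1) ^ k : ℕ) : ℝ) * (GkLat ℓ k a m2 x (x' + Pi.single μ 1) - GkLat ℓ k a m2 x x')) * f x'|
          ≤ c₂ * Fsup := by
  -- any admissible `p₁`, e.g. `p₁ = d + 2`
  have hp : (d : ℝ) + 1 < (d : ℝ) + 2 := by linarith
  obtain ⟨c₂, hc₂, h⟩ := box_constant d ℓ hℓ amin aplus m2plus ha ((d : ℝ) + 2) hp
  obtain ⟨hp0, -⟩ := inv_p₁_bounds (d := d) hp
  refine ⟨c₂, hc₂, fun k hk a m2 h1 h2 h3 h4 μ S f Fsup hF0 hf x => ⟨?_, ?_, ?_⟩⟩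
  · exact lattice_supsup (m2plus := m2plus) hk h3 h4 hc₂.le 0 μ
      (fun i F g hg => h i a h1 h2 0 μ 0 0 le_rfl le_rfl zero_le_one (by linarith) F g hg)
      (KT := fun T x x' => gcube ℓ k T a m2 x x') (kerOf_cube_val (a := a) (m2 := m2) μ)
      (fun x x' => tendsto_gcube hℓ hk (ha.trans_le h1) h3 x x') S f hF0 hf x
  · exact lattice_supsup (m2plus := m2plus) hk h3 h4 hc₂.le 1 μ
      (fun i F g hg => h i a h1 h2 1 μ 0 0 le_rfl le_rfl zero_le_one (by linarith) F g hg)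
      (KT := fun T x x' => (((ℓ + 1) ^ k : ℕ) : ℝ) * (gcube ℓ k T a m2 (x + Pi.single μ 1) x' - gcube ℓ k T a m2 x x'))
      (kerOf_cube_row (a := a) (m2 := m2) μ)
      (fun x x' => ((tendsto_gcube hℓ hk (ha.trans_le h1) h3 _ x').sub
        (tendsto_gcube hℓ hk (ha.trans_le h1) h3 x x')).const_mul _) S f hF0 hf x
  · exact lattice_supsup (m2plus := m2plus) hk h3 h4 hc₂.le 2 μ
      (fun i F g hg => h i a h1 h2 2 μ 0 0 le_rfl le_rfl zero_le_one (by linarith) F g hg)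
      (KT := fun T x x' => (((ℓ + 1) ^ k : ℕ) : ℝ) * (gcube ℓ k T a m2 x (x' + Pi.single μ 1) - gcube ℓ k T a m2 x x'))
      (kerOf_cube_col (a := a) (m2 := m2) μ)
      (fun x x' => ((tendsto_gcube hℓ hk (ha.trans_le h1) h3 x _).sub
        (tendsto_gcube hℓ hk (ha.trans_le h1) h3 x x')).const_mul _) S f hF0 hf x

/-! ### The series form over the whole lattice (`q < ∞`) -/

/-- kernel: a uniform bound `(w·Σ_{x∈Λ}u(x))^t ≤ B` over all finite windows (`u ≥ 0`, `w > 0`, `t > 0`, `B ≥ 0`) gives the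
convergence of `Σ_x u(x)` and `(w·Σ_x u(x))^t ≤ B`. [folklore] -/
private theorem tsum_rpow_le_of_finset {X : Type*} {u : X → ℝ} (hu : ∀ x, 0 ≤ u x) {w t B : ℝ} (hw : 0 < w)
    (ht : 0 < t) (hB : 0 ≤ B) (h : ∀ Λ : Finset X, (w * ∑ x ∈ Λ, u x) ^ t ≤ B) :
    Summable u ∧ (w * ∑' x, u x) ^ t ≤ B := by
  have hfin : ∀ Λ : Finset X, ∑ x ∈ Λ, u x ≤ B ^ t⁻¹ / w := by
    intro Λ
    have h0 : 0 ≤ w * ∑ x ∈ Λ, u x := mul_nonneg hw.le (Finset.sum_nonneg fun x _ => hu x)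
    have h1 : w * ∑ x ∈ Λ, u x ≤ B ^ t⁻¹ := by
      have := Real.rpow_le_rpow (Real.rpow_nonneg h0 t) (h Λ) (inv_nonneg.2 ht.le)
      rwa [Real.rpow_rpow_inv h0 ht.ne'] at this
    rw [le_div_iff₀ hw]
    linarith
  have hs : Summable u := summable_of_sum_le hu hfin
  refine ⟨hs, ?_⟩
  have htsum : ∑' x, u x ≤ B ^ t⁻¹ / w := Real.tsum_le_of_sum_le hu hfin
  have h2 : w * ∑' x, u x ≤ B ^ t⁻¹ := by rwa [le_div_iff₀ hw, mul_comm] at htsum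
  have h0 : 0 ≤ w * ∑' x, u x := mul_nonneg hw.le (tsum_nonneg hu)
  calc (w * ∑' x, u x) ^ t ≤ (B ^ t⁻¹) ^ t := Real.rpow_le_rpow h0 h2 ht.le
    _ = B := Real.rpow_inv_rpow hB ht.ne'

/-- **(2.17), `q < ∞`, SERIES FORM — `G_k(0)` ON `ηℤ^{d+1}`**: for finitely supported `f` (support in `S`) the function
`x ↦ |(G_k(0)f)(x)|^q` is summable over the whole lattice and `‖G_k(0)f‖_q ≤ c₂‖f‖_p`:
`(η^{d+1}Σ_x|Σ_{x′∈S}G_k(0)(x,x′)f(x′)|^{1/t})^t ≤ c₂(η^{d+1}Σ_{x′∈S}|f(x′)|^{1/s})^s` for all `0 < t ≤ s ≤ 1`, `s − 1/p₁ ≤ t`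
(the constant of `GkLat_lpq_le`). [cite: Balaban1983RegularityDecay, Lemma 2.2 (2.17) p.578; dictionary (□ ↦ ηℤ^{d+1}, A = 0, p₁ > d+1)] -/
theorem GkLat_lpq_tsum_le (d ℓ : ℕ) (hℓ : 1 ≤ ℓ) (amin aplus m2plus : ℝ) (ha : 0 < amin) (p₁ : ℝ)
    (hp : (d : ℝ) + 1 < p₁) :
    ∃ c₂ : ℝ, 0 < c₂ ∧ ∀ (k : ℕ), 1 ≤ k → ∀ (a m2 : ℝ), amin ≤ a → a ≤ aplus → 0 ≤ m2 → m2 ≤ m2plus →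
      ∀ (s t : ℝ), 0 < t → t ≤ s → s ≤ 1 → s - 1 / p₁ ≤ t →
      ∀ (S : Finset (Fin (d + 1) → ℤ)) (f : (Fin (d + 1) → ℤ) → ℝ),
        (Summable fun x => |∑ x' ∈ S, GkLat ℓ k a m2 x x' * f x'| ^ (1 / t)) ∧
        (((1 : ℝ) / ((ℓ + 1) ^ k : ℕ)) ^ (d + 1) * ∑' x, |∑ x' ∈ S, GkLat ℓ k a m2 x x' * f x'| ^ (1 / t)) ^ t
          ≤ c₂ * (((1 : ℝ) / ((ℓ + 1) ^ k : ℕ)) ^ (d + 1) * ∑ x' ∈ S, |f x'| ^ (1 / s)) ^ s := by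
  obtain ⟨c₂, hc₂, h⟩ := GkLat_lpq_le d ℓ hℓ amin aplus m2plus ha p₁ hp
  refine ⟨c₂, hc₂, fun k hk a m2 h1 h2 h3 h4 s t ht hts hs1 hpt S f => ?_⟩
  refine tsum_rpow_le_of_finset (fun _ => Real.rpow_nonneg (abs_nonneg _) _) (by positivity) ht
    (mul_nonneg hc₂.le (Real.rpow_nonneg (mul_nonneg (by positivity)
      (Finset.sum_nonneg fun _ _ => Real.rpow_nonneg (abs_nonneg _) _)) _)) fun Λ => ?_
  exact h k hk a m2 h1 h2 h3 h4 s t ht hts hs1 hpt S Λ f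

/-- **(2.17), `q < ∞`, SERIES FORM — `D^η_μG_k(0)` ON `ηℤ^{d+1}`**. [cite: Balaban1983RegularityDecay, Lemma 2.2 (2.17) p.578 (second operator); dictionary (□ ↦ ηℤ^{d+1}, A = 0, p₁ > d+1)] -/
theorem GkLatD_lpq_tsum_le (d ℓ : ℕ) (hℓ : 1 ≤ ℓ) (amin aplus m2plus : ℝ) (ha : 0 < amin) (p₁ : ℝ)
    (hp : (d : ℝ) + 1 < p₁) :
    ∃ c₂ : ℝ, 0 < c₂ ∧ ∀ (k : ℕ), 1 ≤ k → ∀ (a m2 : ℝ), amin ≤ a → a ≤ aplus → 0 ≤ m2 → m2 ≤ m2plus →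
      ∀ (μ : Fin (d + 1)) (s t : ℝ), 0 < t → t ≤ s → s ≤ 1 → s - 1 / p₁ ≤ t →
      ∀ (S : Finset (Fin (d + 1) → ℤ)) (f : (Fin (d + 1) → ℤ) → ℝ),
        (Summable fun x => |∑ x' ∈ S, ((((ℓ + 1) ^ k : ℕ) : ℝ) *
            (GkLat ℓ k a m2 (x + Pi.single μ 1) x' - GkLat ℓ k a m2 x x')) * f x'| ^ (1 / t)) ∧
        (((1 : ℝ) / ((ℓ + 1) ^ k : ℕ)) ^ (d + 1) * ∑' x, |∑ x' ∈ S, ((((ℓ + 1) ^ k : ℕ) : ℝ) *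
            (GkLat ℓ k a m2 (x + Pi.single μ 1) x' - GkLat ℓ k a m2 x x')) * f x'| ^ (1 / t)) ^ t
          ≤ c₂ * (((1 : ℝ) / ((ℓ + 1) ^ k : ℕ)) ^ (d + 1) * ∑ x' ∈ S, |f x'| ^ (1 / s)) ^ s := by
  obtain ⟨c₂, hc₂, h⟩ := GkLatD_lpq_le d ℓ hℓ amin aplus m2plus ha p₁ hp
  refine ⟨c₂, hc₂, fun k hk a m2 h1 h2 h3 h4 μ s t ht hts hs1 hpt S f => ?_⟩
  refine tsum_rpow_le_of_finset (fun _ => Real.rpow_nonneg (abs_nonneg _) _) (by positivity) ht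
    (mul_nonneg hc₂.le (Real.rpow_nonneg (mul_nonneg (by positivity)
      (Finset.sum_nonneg fun _ _ => Real.rpow_nonneg (abs_nonneg _) _)) _)) fun Λ => ?_
  exact h k hk a m2 h1 h2 h3 h4 μ s t ht hts hs1 hpt S Λ f

/-- **(2.17), `q < ∞`, SERIES FORM — `G_k(0)D^{η*}_μ` ON `ηℤ^{d+1}`**. [cite: Balaban1983RegularityDecay, Lemma 2.2 (2.17) p.578 (third operator); dictionary (□ ↦ ηℤ^{d+1}, A = 0, p₁ > d+1)] -/
theorem GkLatDadj_lpq_tsum_le (d ℓ : ℕ) (hℓ : 1 ≤ ℓ) (amin aplus m2plus : ℝ) (ha : 0 < amin) (p₁ : ℝ)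
    (hp : (d : ℝ) + 1 < p₁) :
    ∃ c₂ : ℝ, 0 < c₂ ∧ ∀ (k : ℕ), 1 ≤ k → ∀ (a m2 : ℝ), amin ≤ a → a ≤ aplus → 0 ≤ m2 → m2 ≤ m2plus →
      ∀ (μ : Fin (d + 1)) (s t : ℝ), 0 < t → t ≤ s → s ≤ 1 → s - 1 / p₁ ≤ t →
      ∀ (S : Finset (Fin (d + 1) → ℤ)) (f : (Fin (d + 1) → ℤ) → ℝ),
        (Summable fun x => |∑ x' ∈ S, ((((ℓ + 1) ^ k : ℕ) : ℝ) *
            (GkLat ℓ k a m2 x (x' + Pi.single μ 1) - GkLat ℓ k a m2 x x')) * f x'| ^ (1 / t)) ∧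
        (((1 : ℝ) / ((ℓ + 1) ^ k : ℕ)) ^ (d + 1) * ∑' x, |∑ x' ∈ S, ((((ℓ + 1) ^ k : ℕ) : ℝ) *
            (GkLat ℓ k a m2 x (x' + Pi.single μ 1) - GkLat ℓ k a m2 x x')) * f x'| ^ (1 / t)) ^ t
          ≤ c₂ * (((1 : ℝ) / ((ℓ + 1) ^ k : ℕ)) ^ (d + 1) * ∑ x' ∈ S, |f x'| ^ (1 / s)) ^ s := by
  obtain ⟨c₂, hc₂, h⟩ := GkLatDadj_lpq_le d ℓ hℓ amin aplus m2plus ha p₁ hp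
  refine ⟨c₂, hc₂, fun k hk a m2 h1 h2 h3 h4 μ s t ht hts hs1 hpt S f => ?_⟩
  refine tsum_rpow_le_of_finset (fun _ => Real.rpow_nonneg (abs_nonneg _) _) (by positivity) ht
    (mul_nonneg hc₂.le (Real.rpow_nonneg (mul_nonneg (by positivity)
      (Finset.sum_nonneg fun _ _ => Real.rpow_nonneg (abs_nonneg _) _)) _)) fun Λ => ?_
  exact h k hk a m2 h1 h2 h3 h4 μ s t ht hts hs1 hpt S Λ f

end Main

/-! ## §4 Non-vacuity: the hypotheses are met (`d + 1 = 4`, `L = 2`, `a ∈ [1/2, 2]`, `m² ∈ [0, 1]`, `p₁ = 5`,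
`(p, q) = (1, 5/4)`, `(p, q) = (5, ∞)`) -/

/-- (2.17) off the diagonal at the physical dimension `d + 1 = 4`, `L = 2`, `p₁ = 5`: the statement for `G_k(0)`. -/
example : ∃ c₂ : ℝ, 0 < c₂ ∧ ∀ (k : ℕ), 1 ≤ k → ∀ (a m2 : ℝ), (1 / 2 : ℝ) ≤ a → a ≤ 2 → 0 ≤ m2 → m2 ≤ 1 →
      ∀ (s t : ℝ), 0 < t → t ≤ s → s ≤ 1 → s - 1 / 5 ≤ t →
      ∀ (S Λ : Finset (Fin (3 + 1) → ℤ)) (f : (Fin (3 + 1) → ℤ) → ℝ),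
        (((1 : ℝ) / ((1 + 1) ^ k : ℕ)) ^ (3 + 1) * ∑ x ∈ Λ, |∑ x' ∈ S, GkLat 1 k a m2 x x' * f x'| ^ (1 / t)) ^ t
          ≤ c₂ * (((1 : ℝ) / ((1 + 1) ^ k : ℕ)) ^ (3 + 1) * ∑ x' ∈ S, |f x'| ^ (1 / s)) ^ s :=
  GkLat_lpq_le 3 1 le_rfl (1 / 2) 2 1 (by norm_num) 5 (by norm_num)

/-- the quantifier prefixes are inhabited: `k = 1`, `a = 1`, `m² = 0`, `(s, t) = (1, 4/5)` (i.e. `p = 1`, `q = 5/4`,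
`1/p − 1/q = 1/5 = 1/p₁`) for the `q < ∞` statements, and `s = 1/5` (`p = p₁ = 5`) for the `q = ∞` statements. -/
example : (1 : ℕ) ≤ 1 ∧ (1 / 2 : ℝ) ≤ 1 ∧ (1 : ℝ) ≤ 2 ∧ (0 : ℝ) ≤ 0 ∧ (0 : ℝ) ≤ 1 ∧
    ((0 : ℝ) < 4 / 5 ∧ (4 / 5 : ℝ) ≤ 1 ∧ (1 : ℝ) ≤ 1 ∧ (1 : ℝ) - 1 / 5 ≤ 4 / 5) ∧
    ((0 : ℝ) < 1 / 5 ∧ (1 / 5 : ℝ) ≤ 1 / 5) :=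
  ⟨le_rfl, by norm_num, by norm_num, le_rfl, by norm_num, ⟨by norm_num, by norm_num, le_rfl, by norm_num⟩,
    ⟨by norm_num, le_rfl⟩⟩

end

end Literature.MathematicalPhysics.QuantumFieldTheory.Balaban1983to89.B4Lemma22ZeroLatticeLpLq
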